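import Summits.ABC.IUTFork.Thm311LinkLattice
import Summits.ABC.IUTFork.Thm311Checks
import Literature.IUT.LogThetaLattice.LatticeGlue
import Literature.IUT.LogThetaLattice.RadialDataCore
import Literature.IUT.LogThetaLattice.StripFrameWitness
import Mathlib.CategoryTheory.Core
import Mathlib.CategoryTheory.Discrete.Basic
import Mathlib.CategoryTheory.Groupoid
import HarnessLib

/-!
# [IUTchIII] Theorem 3.11 in the author's terms, L: the objects of (iii) over L6's glued §1–§2 data, and their non-vacuity

Record-only file (D-0012) of the abc-iut cell (Cor. 3.12 sub-crew, seat abc-iut-c312-1, gen 2); TAKES NO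
SIDE. Sequel to J (`Thm311LinkLattice`), whose `LinkData.ofFunctors` constructed the objects of [IUTchIII]
Thm. 3.11 (iii) (kurims `paper:url-4b091feeb646` pp. 156–159) functorially in the lattice, leaving free the
`F^{⊢×μ}_{env}` functor with its Prop. 2.1 (vi) natural isomorphism and the radial / `∞κ` data as functors
`S.DHT ⥤ Rad`. Seat abc-iut-L6-t3 has since landed `LatticeGlue` (the identifications between the §1–§2
interface files; `LatticeGlue.envNat` = Prop. 2.1 (vi) on `BiCores`' objects), `RadialDataCore`
(`Radial.coreFunctor : Core S.DHT ⥤ Radial E` — Cor. 2.3's radial data are functorial in ISOMORPHISMS of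
`D`-`Θ^{±ell}NF`-Hodge theaters: "(b_{Morℜ}), (c_{Morℜ}) the isomorphisms induced by" one, p. 73) and
`StripFrameWitness`. This file:

* `LinkData.ofFunctorsCore` — J's constructor with radial / `∞κ` data on the CORE `Core S.DHT` (all the text
  uses: the permutation symmetries and "arbitrary automorphisms" of (iii) (c), (d) are isomorphisms); the
  permutation-symmetry poly-isomorphisms are the images of the FULL poly-isomorphism of the core (= all
  isomorphisms `^{n,∘}HT^D ⥲ ^{n+1,∘}HT^D`); (iii) (c), (d) AS TYPED hold for every such instantiation
  (`ofFunctorsCore_partIIIc/_partIIId`: Kummer naturality + J's `PolyIsoCalc.stabilized_map_full`).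
* `LinkData.ofGlue G Λ FR FM` — the objects of (iii) for an L6 log-theta-lattice `Λ : LogThetaLatticeDiagram
  G.logData G.linkData` ([IUTchIII] Def. 1.4 / 3.8 (iii)) over `G : LatticeGlue S`: `F^{⊢×μ}_△` Frobenius-like /
  étale-like functors and Kummer natural isomorphism from `G.biCoric` (Thm. 1.5 (iii)), `F^{⊢×μ}_{env}` /
  Prop. 2.1 (vi) from `G.fxmEnvD` / `G.envNat`; `LinkData.ofGlueRadial G Λ FM` moreover takes `^{n,∘}R` from
  Cor. 2.3's typing (`Radial.coreFunctor G.coric`; `ofGlueRadial_R`: `^{n,∘}R = ⟨^{n,∘}HT^D⟩`, rfl), so that ONLY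
  the `∞κ` functor `FM` ([IUTchII] Cor. 4.7 (iii); Rmk. 2.3.2 "similar … left to the reader"; no L6 typing
  yet) remains an argument. `FullSituation.statement_iff_of_glue`: Theorem 3.11 as typed over such data is
  `PartI ∧ PartII` (bookkeeping, neutral, as in J).
* §4 NON-VACUITY (cell rule "vacuity-audit every fork-level hypothesis … with a non-vacuity witness"): the
  ONE-POINT MODEL `Checks.toyStripFrame : StripFrame.{0}` / `Checks.toyBiCoric` of L6-t3's interfaces (all
  categories the one-object discrete category, all functors / natural isomorphisms identities, all printed
  poly-isomorphisms full), J's `ofBiCoric` over it (`Checks.toyLinkJ`) and E's toy (i)/(ii)-situation with that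
  link (`Checks.toyFullJ`): the typed Theorem 3.11 HOLDS there (`toyFullJ_statement`; E's
  `exists_not_statement`: not a tautology). Conversely `Checks.skewLink_not_partIIIc`: D's (iii) (c) AS TYPED
  is NOT automatic for ARBITRARY link data — over L6-t3's witness groupoid `Witness.Pt = SingleObj ℤˣ`
  (`negIso ≠ Iso.refl`) link data whose "induced automorphism" is `−1` on `^{n,m}F^{⊢×μ}_△` but `1` on
  `F^{⊢×μ}_△(^{n,∘}D^⊢_△)` violate the equivariance clause; so D's `PartIIIc` carries content exactly until the
  objects are made functorial (J), which is what the printed "in the sense that these constructions are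
  stabilized/equivariant/functorial" (p. 158) asks. Nothing in §4 models any arithmetic.

Sources read on the page: as J. [claim: Mochizuki2012, status: disputed]
Deliberately NOT here: any change to A–K, J; the `∞κ` data; any judgement.
-/

noncomputable section

namespace Summit.ABC

namespace IUTFork

namespace Thm311

open CategoryTheory
open Literature.IUT.HodgeTheaters (PolyIso)
open Literature.IUT.LogThetaLattice

namespace LinkData

variable {S : StripFrame.{0}}

/-! ## 1. Radial / `∞κ` data functorial on the core of the `D`-Hodge-theater category -/

/-- **The objects of Thm. 3.11 (iii), CONSTRUCTED** as in J's `ofFunctors`, except that the radial data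
`^{n,∘}R` (Cor. 2.3) and the `κ`-sol/`∞κ` data ([IUTchII] Cor. 4.7 (iii)) are functors on the CORE `Core S.DHT`
(isomorphisms of `D`-`Θ^{±ell}NF`-Hodge theaters only — Cor. 2.3: morphisms of radial data are "induced by"
isomorphisms of `D`-Hodge theaters). The permutation-symmetry poly-isomorphisms are the images of the full
poly-isomorphism `^{n,∘}HT^D ⥲ ^{n+1,∘}HT^D` (all isomorphisms, as morphisms of the core); `Aut(^{n,m}HT)` acts
through `D(−)`, the transport `ξ n m` and `Core.isoMk`. [claim: Mochizuki2012, status: disputed] -/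
def ofFunctorsCore (H : ℤ × ℤ → S.HT) (Dl : ℤ → S.DHT) (ξ : ∀ n m : ℤ, S.htToD.obj (H (n, m)) ≅ Dl n)
    (Ffr : S.HT ⥤ S.Fxm) (Fet : S.DHT ⥤ S.Fxm) (kum : Ffr ≅ S.htToD ⋙ Fet)
    (Fenv : S.DHT ⥤ S.Fxm) (nat : Fet ≅ Fenv)
    {Rad : Type} [Category.{0} Rad] (FR : Core S.DHT ⥤ Rad)
    {Kap : Type} [Category.{0} Kap] (FM : Core S.DHT ⥤ Kap) : LinkData where
  Strip := S.Fxm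
  Fdelta n m := Ffr.obj (H (n, m))
  FdeltaD n := Fet.obj (Dl n)
  kumDelta n m := kumAt Ffr Fet kum (H (n, m)) ≪≫ Fet.mapIso (ξ n m)
  FenvD n := Fenv.obj (Dl n)
  natEnvD n := nat.app (Dl n)
  Rad := Rad
  R n := FR.obj ⟨Dl n⟩
  permR n := (PolyIso.full (⟨Dl n⟩ : Core S.DHT) ⟨Dl (n + 1)⟩).map FR
  Kap := Kap
  Mk n := FM.obj ⟨Dl n⟩
  permM n := (PolyIso.full (⟨Dl n⟩ : Core S.DHT) ⟨Dl (n + 1)⟩).map FM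
  AutHT n m := H (n, m) ≅ H (n, m)
  onDelta _ _ a := Ffr.mapIso a
  onDeltaD n m a := Fet.mapIso (autD H Dl ξ n m a)
  onR n m a := FR.mapIso (Core.isoMk (autD H Dl ξ n m a))
  onM n m a := FM.mapIso (Core.isoMk (autD H Dl ξ n m a))

section

variable (H : ℤ × ℤ → S.HT) (Dl : ℤ → S.DHT) (ξ : ∀ n m : ℤ, S.htToD.obj (H (n, m)) ≅ Dl n)
  (Ffr : S.HT ⥤ S.Fxm) (Fet : S.DHT ⥤ S.Fxm) (kum : Ffr ≅ S.htToD ⋙ Fet)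
  (Fenv : S.DHT ⥤ S.Fxm) (nat : Fet ≅ Fenv)
  {Rad : Type} [Category.{0} Rad] (FR : Core S.DHT ⥤ Rad)
  {Kap : Type} [Category.{0} Kap] (FM : Core S.DHT ⥤ Kap)

/-- (iii) (c) AS TYPED holds for `ofFunctorsCore`: equivariance of the Kummer isomorphism is its naturality
(J `kumAt_naturality`); the permutation-symmetry poly-isomorphism, image of the full poly-isomorphism of the
core, is stabilized by the functorially induced automorphisms (J `PolyIsoCalc.stabilized_map_full`).
BOOKKEEPING, neutral. [folklore] -/
theorem ofFunctorsCore_partIIIc : (ofFunctorsCore H Dl ξ Ffr Fet kum Fenv nat FR FM).PartIIIc := by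
  intro n m
  refine ⟨?_, ?_⟩
  · rintro p ⟨a, rfl⟩
    change H (n, m) ≅ H (n, m) at a
    change Ffr.mapIso a ≪≫ (kumAt Ffr Fet kum (H (n, m)) ≪≫ Fet.mapIso (ξ n m)) =
      (kumAt Ffr Fet kum (H (n, m)) ≪≫ Fet.mapIso (ξ n m)) ≪≫
        Fet.mapIso ((ξ n m).symm ≪≫ S.htToD.mapIso a ≪≫ ξ n m)
    rw [← Iso.trans_assoc, kumAt_naturality, Iso.trans_assoc, Iso.trans_assoc, ← Functor.mapIso_trans,
      ← Functor.mapIso_trans, Iso.self_symm_id_assoc]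
  · refine PolyIsoCalc.stabilized_map_full FR ⟨Dl n⟩ ⟨Dl (n + 1)⟩ _ _ ?_ ?_
    · rintro a ⟨α, rfl⟩; exact ⟨Core.isoMk (autD H Dl ξ n m α), rfl⟩
    · rintro b ⟨β, rfl⟩; exact ⟨Core.isoMk (autD H Dl ξ (n + 1) m β), rfl⟩

/-- (iii) (d) AS TYPED holds for `ofFunctorsCore`. BOOKKEEPING, neutral. [folklore] -/
theorem ofFunctorsCore_partIIId : (ofFunctorsCore H Dl ξ Ffr Fet kum Fenv nat FR FM).PartIIId := by
  intro n m
  refine PolyIsoCalc.stabilized_map_full FM ⟨Dl n⟩ ⟨Dl (n + 1)⟩ _ _ ?_ ?_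
  · rintro a ⟨α, rfl⟩; exact ⟨Core.isoMk (autD H Dl ξ n m α), rfl⟩
  · rintro b ⟨β, rfl⟩; exact ⟨Core.isoMk (autD H Dl ξ (n + 1) m β), rfl⟩

end

/-! ## 2. Over L6's glued §1–§2 data -/

/-- **The objects of Thm. 3.11 (iii) for an L6 log-theta-lattice over glued §1–§2 data**: `Λ :
LogThetaLatticeDiagram G.logData G.linkData` ([IUTchIII] Def. 1.4; Def. 3.8 (iii) for the LGP-Gaussian case,
Rmk. 3.8.2), `G : LatticeGlue S` (L6-t3): line representatives `^{n,∘}HT^D := D(^{n,0}HT)` identified along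
J's `lineIso` (a choice inside the vertical full poly-isomorphism, Thm. 1.5 (i)); Frobenius-like
`G.biCoric.fxmDeltaHT`, étale-like `G.biCoric.dvDelta ⋙ G.biCoric.fxmOfDv` and the Kummer natural
isomorphism `G.biCoric.kummer` (Thm. 1.5 (iii)); `F^{⊢×μ}_{env}` := `G.fxmEnvD` with Prop. 2.1 (vi) :=
`G.envNat`; radial data `FR` (Cor. 2.3) and `∞κ` data `FM` ([IUTchII] Cor. 4.7 (iii)) on the core.
[claim: Mochizuki2012, status: disputed] -/
def ofGlue (G : LatticeGlue S) (Λ : LogThetaLatticeDiagram G.logData G.linkData)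
    {Rad : Type} [Category.{0} Rad] (FR : Core S.DHT ⥤ Rad) {Kap : Type} [Category.{0} Kap]
    (FM : Core S.DHT ⥤ Kap) : LinkData :=
  ofFunctorsCore Λ.HT (fun n => S.htToD.obj (Λ.HT (n, 0))) (lineIso Λ) G.biCoric.fxmDeltaHT
    (G.biCoric.dvDelta ⋙ G.biCoric.fxmOfDv) G.biCoric.kummer G.fxmEnvD G.envNat FR FM

section

variable (G : LatticeGlue S) (Λ : LogThetaLatticeDiagram G.logData G.linkData)
  {Rad : Type} [Category.{0} Rad] (FR : Core S.DHT ⥤ Rad) {Kap : Type} [Category.{0} Kap]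
  (FM : Core S.DHT ⥤ Kap)

/-- DICTIONARY: the Kummer isomorphism of (iii) (a) for `ofGlue` is `BiCoricData.kummerAt (^{n,m}HT)` followed by
the transport to the line representative along `lineIso` — definitionally. [claim: Mochizuki2012, status: disputed] -/
theorem ofGlue_kumDelta (n m : ℤ) :
    (ofGlue G Λ FR FM).kumDelta n m =
      G.biCoric.kummerAt (Λ.HT (n, m)) ≪≫ G.biCoric.fxmOfDv.mapIso (G.biCoric.dvDelta.mapIso (lineIso Λ n m)) :=
  rfl

/-- DICTIONARY: the natural isomorphism `F^{⊢×μ}_△(^{n,∘}D^⊢_△) ⥲ F^{⊢×μ}_{env}(^{n,∘}D_>)` of (iii) (b) for `ofGlue`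
is L6's `LatticeGlue.envNat` (Prop. 2.1 (vi) `ThetaMonoidData.unitPortionD` transported along the glue) at
the line representative — definitionally. [claim: Mochizuki2012, status: disputed] -/
theorem ofGlue_natEnvD (n : ℤ) :
    (ofGlue G Λ FR FM).natEnvD n = G.envNat.app (S.htToD.obj (Λ.HT (n, 0))) := rfl

/-- (iii) (c) and (d) AS TYPED hold for `ofGlue` (every `G`, `Λ`, `FR`, `FM`). BOOKKEEPING, neutral. [folklore] -/
theorem ofGlue_partIIIc_partIIId : (ofGlue G Λ FR FM).PartIIIc ∧ (ofGlue G Λ FR FM).PartIIId :=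
  ⟨ofFunctorsCore_partIIIc _ _ _ _ _ _ _ _ FR FM, ofFunctorsCore_partIIId _ _ _ _ _ _ _ _ FR FM⟩

end

/-! ### 2b. … with Cor. 2.3's radial data (L6 `Radial.coreFunctor`) -/

/-- **The objects of Thm. 3.11 (iii) with the radial data `^{n,∘}R` of [IUTchIII] Cor. 2.3 (ii)** taken from L6's
typing: `Rad := Radial G.coric` (Cor. 2.3's category of radial data `†ℜ`, a groupoid) and `FR :=
Radial.coreFunctor G.coric` ("each `D-Θ^{±ell}NF`-Hodge theater … defines, in an evident way, an associated
collection of radial data", functorial in isomorphisms of `D`-Hodge theaters, p. 74). Only the `∞κ` data `FM`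
of [IUTchII] Cor. 4.7 (iii) remain an argument. [claim: Mochizuki2012, status: disputed] -/
def ofGlueRadial (G : LatticeGlue S) (Λ : LogThetaLatticeDiagram G.logData G.linkData) {Kap : Type}
    [Category.{0} Kap] (FM : Core S.DHT ⥤ Kap) : LinkData :=
  ofGlue G Λ (Radial.coreFunctor G.coric) FM

section

variable (G : LatticeGlue S) (Λ : LogThetaLatticeDiagram G.logData G.linkData) {Kap : Type}
  [Category.{0} Kap] (FM : Core S.DHT ⥤ Kap)

/-- DICTIONARY: `^{n,∘}R` of `ofGlueRadial` is Cor. 2.3 (ii)'s radial datum of the line representative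
`^{n,∘}HT^D = D(^{n,0}HT)`, i.e. L6's `latticeRadial G.coric (D ∘ ^{·,·}HT) (n, 0)` — definitionally.
[claim: Mochizuki2012, status: disputed] -/
theorem ofGlueRadial_R (n : ℤ) :
    (ofGlueRadial G Λ FM).R n = latticeRadial G.coric (fun p => S.htToD.obj (Λ.HT p)) (n, 0) := rfl

/-- (iii) (c) and (d) AS TYPED hold for `ofGlueRadial`. BOOKKEEPING, neutral. [folklore] -/
theorem ofGlueRadial_partIIIc_partIIId :
    (ofGlueRadial G Λ FM).PartIIIc ∧ (ofGlueRadial G Λ FM).PartIIId :=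
  ofGlue_partIIIc_partIIId G Λ _ FM

end

end LinkData

/-! ## 3. Consequence for Theorem 3.11 as typed -/

namespace FullSituation

variable {T : ThetaIndex}

/-- The full situation with (i)/(ii)-data `S₀` and (iii)-objects `LinkData.ofGlue G Λ FR FM`.
[claim: Mochizuki2012, status: disputed] -/
def ofGlue (S₀ : LatticeSituation T) {F : StripFrame.{0}} (G : LatticeGlue F)
    (Λ : LogThetaLatticeDiagram G.logData G.linkData) {Rad : Type} [Category.{0} Rad]
    (FR : Core F.DHT ⥤ Rad) {Kap : Type} [Category.{0} Kap] (FM : Core F.DHT ⥤ Kap) : FullSituation T :=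
  { S₀ with link := LinkData.ofGlue G Λ FR FM }

/-- **Theorem 3.11 as typed, over an L6 log-theta-lattice with glued §1–§2 data, is (i) ∧ (ii)** (J's
`statement_iff_partI_partII_of_link` with `ofGlue_partIIIc_partIIId`). BOOKKEEPING, neutral. [folklore] -/
theorem statement_iff_of_glue (S₀ : LatticeSituation T) {F : StripFrame.{0}} (G : LatticeGlue F)
    (Λ : LogThetaLatticeDiagram G.logData G.linkData) {Rad : Type} [Category.{0} Rad]
    (FR : Core F.DHT ⥤ Rad) {Kap : Type} [Category.{0} Kap] (FM : Core F.DHT ⥤ Kap) :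
    (ofGlue S₀ G Λ FR FM).Statement ↔ S₀.PartI ∧ S₀.PartII :=
  (ofGlue S₀ G Λ FR FM).statement_iff_partI_partII_of_link
    (LinkData.ofGlue_partIIIc_partIIId G Λ FR FM).1 (LinkData.ofGlue_partIIIc_partIIId G Λ FR FM).2

end FullSituation

/-! ## 4. Non-vacuity: the one-point model -/

namespace Checks

/-! ### 4a. The one-point model of the [IUTchIII] §1 frame and bi-coric data -/

/-- The one-object discrete category (every prime-strip / Hodge-theater category of the toy). [folklore] -/
abbrev Pt : Type := Discrete PUnit.{1}
/-- Its unique object. [folklore] -/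
abbrev pt : Pt := ⟨⟨⟩⟩

/-- Any two objects of `Pt` are isomorphic (they are equal). [folklore] -/
def ptIso (X Y : Pt) : X ≅ Y := Discrete.eqToIso rfl

/-- Isomorphism sets in `Pt` are subsingletons. [folklore] -/
instance (X Y : Pt) : Subsingleton (X ≅ Y) := ⟨fun _ _ => Iso.ext (Subsingleton.elim _ _)⟩
/-- ONE-POINT MODEL of the prime-strip/Hodge-theater frame of [IUTchIII] §1 (L6-t3 `StripFrame`, Def. 1.1):
all ten categories are `Pt`, all functors identities, all natural isomorphisms identities; [IUTchI] Cor. 5.3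
(ii)/(iii) rigidity and the connectedness fields hold trivially. Shows the interface is instantiable.
[folklore] -/
def toyStripFrame : StripFrame.{0} where
  F := Pt
  Fv := Pt
  Fxm := Pt
  Fvtxm := Pt
  Fgl := Pt
  Fglxm := Pt
  D := Pt
  Dv := Pt
  HT := Pt
  DHT := Pt
  toD := 𝟭 Pt
  toFv := 𝟭 Pt
  FvToDv := 𝟭 Pt
  DToDv := 𝟭 Pt
  FvToFxm := 𝟭 Pt
  FxmToDv := 𝟭 Pt
  FglToFv := 𝟭 Pt
  FglToFglxm := 𝟭 Pt
  FglxmToFvtxm := 𝟭 Pt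
  FvtxmToFxm := 𝟭 Pt
  toDv_comm := Iso.refl _
  fxm_comm := Iso.refl _
  htToD := 𝟭 Pt
  Label := PUnit
  strip _ := 𝟭 Pt
  dstrip _ := 𝟭 Pt
  strip_comm _ := Iso.refl _
  toD_isoBij X Y := ⟨Function.injective_of_subsingleton _, fun _ => ⟨ptIso X Y, Subsingleton.elim _ _⟩⟩
  toDv_isoSurj X Y := fun _ => ⟨ptIso X Y, Subsingleton.elim _ _⟩
  iso_nonempty_F X Y := ⟨ptIso X Y⟩
  iso_nonempty_Fxm X Y := ⟨ptIso X Y⟩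
  iso_nonempty_Fglxm X Y := ⟨ptIso X Y⟩
  iso_nonempty_DHT X Y := ⟨ptIso X Y⟩

/-- ONE-POINT MODEL of L6-t3's `BiCoricData` ([IUTchIII] Def. 1.1 (iv)–(vi), Prop. 1.2 (vi)–(ix), Thm. 1.5
(iii)–(v)) over `toyStripFrame`: log-shell and realified-Frobenioid categories `Pt`, all functorial
algorithms identities, all printed poly-isomorphisms full, the Kummer natural isomorphism the identity.
Shows the interface is instantiable. [folklore] -/
def toyBiCoric : BiCoricData toyStripFrame where
  Sh := Pt
  holShell := 𝟭 Pt
  fxmShell := 𝟭 Pt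
  monoShell := 𝟭 Pt
  monoFxm _ := PolyIso.full _ _
  monoFxm_nonempty _ := ⟨ptIso _ _, PolyIso.mem_full _⟩
  monoFxm_map _ _ _ := PolyIso.mem_full _
  monoFxmOfF _ := PolyIso.full _ _
  monoFxmOfF_nonempty _ := ⟨ptIso _ _, PolyIso.mem_full _⟩
  monoFxmOfF_le _ := fun _ _ => PolyIso.mem_full _
  fxmHol _ := PolyIso.full _ _
  fxmHol_nonempty _ := ⟨ptIso _ _, PolyIso.mem_full _⟩
  FofD := 𝟭 Pt
  FofD_D := Iso.refl _
  fxmOfDv := 𝟭 Pt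
  fxmOfDv_dv := Iso.refl _
  dvDelta := 𝟭 Pt
  succ := PUnit.unit
  fxOfDsucc := 𝟭 Pt
  fxOfDsucc_delta := Iso.refl _
  fxmDeltaHT := 𝟭 Pt
  kummer := Iso.refl _
  RFrob := Pt
  realified := 𝟭 Pt
  realifiedHT := 𝟭 Pt
  realifiedKummer _ := PolyIso.full _ _
  realifiedKummer_nonempty _ := ⟨ptIso _ _, PolyIso.mem_full _⟩

/-! ### 4b. J instantiated -/

/-- J's `LinkData.ofBiCoric` over the one-point model: lattice, line representatives, `F^{⊢×μ}_{env}`, radial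
and `∞κ` data all the point / the identity. [folklore] -/
def toyLinkJ : LinkData :=
  LinkData.ofBiCoric toyBiCoric (fun _ => pt) (fun _ => pt) (fun _ _ => Iso.refl pt) (𝟭 Pt)
    (Iso.refl _) (𝟭 Pt) (𝟭 Pt)

/-- (iii) (c) as typed holds for the instantiated constructed link (instance of J's theorem). [folklore] -/
theorem toyLinkJ_partIIIc : toyLinkJ.PartIIIc :=
  LinkData.ofBiCoric_partIIIc toyBiCoric _ _ _ (𝟭 Pt) (Iso.refl _) (𝟭 Pt) (𝟭 Pt)

/-- (iii) (d) as typed holds for the instantiated constructed link (instance of J's theorem). [folklore] -/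
theorem toyLinkJ_partIIId : toyLinkJ.PartIIId :=
  LinkData.ofBiCoric_partIIId toyBiCoric _ _ _ (𝟭 Pt) (Iso.refl _) (𝟭 Pt) (𝟭 Pt)

/-- E's toy (i)/(ii)-situation (`toyFull.toLatticeSituation`) with the (iii)-objects CONSTRUCTED by J.
[folklore] -/
def toyFullJ : FullSituation toyIndex :=
  { toyFull.toLatticeSituation with link := toyLinkJ }

/-- The typed Theorem 3.11 over the constructed link reduces to (i) ∧ (ii) (J). [folklore] -/
theorem toyFullJ_statement_iff : toyFullJ.Statement ↔ toyFullJ.PartI ∧ toyFullJ.toLatticeSituation.PartII :=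
  toyFullJ.statement_iff_partI_partII_of_link toyLinkJ_partIIIc toyLinkJ_partIIId

/-- CONSISTENCY WITNESS: the typed Theorem 3.11 holds in the one-point model with J's constructed
(iii)-objects ((i), (ii) from E). Together with E's `exists_not_statement` (it fails elsewhere): J's theorems
concern a nonempty, non-trivial class of instantiations. [folklore] -/
theorem toyFullJ_statement : toyFullJ.Statement :=
  toyFullJ_statement_iff.2 ⟨toy_partI, toy_partII⟩

/-! ### 4c. (iii) (c) as typed is not automatic for non-functorial link data -/

/-- Link data over L6-t3's witness groupoid `Witness.Pt = SingleObj ℤˣ` (one object whose automorphism group is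
`{±1}`): all objects the point, the Kummer and natural isomorphisms the identity, but the automorphism of
`^{n,m}F^{⊢×μ}_△` "induced" by the (unique) automorphism of `^{n,m}HT` is `−1` (`Witness.negIso`) while the one
induced on `F^{⊢×μ}_△(^{n,∘}D^⊢_△)` is `1` — NOT of the form `LinkData.ofFunctors` (there both are images of the
same automorphism under functors intertwined by a natural isomorphism). [folklore] -/
def skewLink : LinkData where
  Strip := Witness.Pt
  Fdelta _ _ := Witness.pt
  FdeltaD _ := Witness.pt
  kumDelta _ _ := Iso.refl _
  FenvD _ := Witness.pt
  natEnvD _ := Iso.refl _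
  Rad := Witness.Pt
  R _ := Witness.pt
  permR _ := PolyIso.full _ _
  Kap := Witness.Pt
  Mk _ := Witness.pt
  permM _ := PolyIso.full _ _
  AutHT _ _ := Unit
  onDelta _ _ _ := Witness.negIso
  onDeltaD _ _ _ := Iso.refl _
  onR _ _ _ := Iso.refl _
  onM _ _ _ := Iso.refl _

/-- NON-TAUTOLOGY of D's (iii) (c) for arbitrary link data: `skewLink` violates the equivariance clause
(`−1 ∘ id ≠ id ∘ 1`). Contrast J: for functorially constructed link data (iii) (c) always holds. [folklore] -/
theorem skewLink_not_partIIIc : ¬ skewLink.PartIIIc := by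
  intro h
  have h00 : Witness.negIso ≪≫ Iso.refl Witness.pt = Iso.refl Witness.pt ≪≫ Iso.refl Witness.pt :=
    (h 0 0).1 (Witness.negIso, Iso.refl Witness.pt) ⟨(), rfl⟩
  rw [Iso.trans_refl, Iso.refl_trans] at h00
  exact Witness.negIso_ne_refl h00

/-- Hence D's `LinkData.PartIIIc` is satisfiable (`toyLinkJ_partIIIc`) and refutable (`skewLink_not_partIIIc`):
it carries content exactly until the objects of (iii) are made functorial in the lattice (J, this file).
[folklore] -/
theorem partIIIc_independent : (∃ K : LinkData, K.PartIIIc) ∧ ∃ K : LinkData, ¬ K.PartIIIc :=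
  ⟨⟨toyLinkJ, toyLinkJ_partIIIc⟩, ⟨skewLink, skewLink_not_partIIIc⟩⟩

end Checks

end Thm311

end IUTFork

end Summit.ABC

end
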